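import Literature.Topology.FourManifolds.KhCurlRotate
import Literature.Topology.FourManifolds.KhBigon
import Literature.Topology.FourManifolds.KhComplexTransportProofs
import HarnessLib

/-!
# Erasing a chord of a Gauss diagram; Khovanov homology of a diagram with an isolated kink

Sibling file of `KhComplex.lean`. `GaussDiagram.insertChord` adds a chord (the operation
behind `Ω1`, `Ω2`); this file provides the inverse bookkeeping:

* `eraseChord x` — the Gauss diagram with the chord `x` removed (the two marked points deleted
  and the others renumbered in order, the other chords renumbered in order);
* `insertChord_eraseChord` — **reconstruction**: re-inserting the erased chord at its old
  positions gives back `G` with its chords renumbered (`G.relabel (eraseCycle x)`);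
* `nonempty_iso_khovanovHomology_eraseChord_of_kink` — **a chord with adjacent endpoints (an
  isolated kink, in either order) can be erased without changing Khovanov homology**: the first
  Reidemeister move (`nonempty_iso_khovanovHomology_omega1a/omega1b`, `KhCurlRotate.lean`) read
  backwards, combined with independence of the numbering of the chords
  (`nonempty_iso_khovanovHomology_relabel`).

Used for the degenerate instance `x = z` of `PolyakMove.omega3a` (a kink inside the span of a
kink). No named fact is introduced.

## References

* M. Polyak, *Minimal generating sets of Reidemeister moves*, Quantum Topol. 1 (2010), §2
  (insertion/deletion of arrows). [cite: Polyak2010, §2]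
* M. Khovanov, *A categorification of the Jones polynomial*, Duke Math. J. 101 (2000), §5.1
  (first move), §3.3 (ordering of crossings). [cite: Khovanov2000, §5.1]
-/

open CategoryTheory Function

namespace Literature.Topology.FourManifolds

namespace GaussDiagram

variable (G : GaussDiagram) (x : Fin G.n)

/-! ## Deleting two marked points and a chord index -/

/-- **Compression of the marked points** after deleting the two endpoints of the chord `x`: the
point `q` goes down by the number of deleted points below it. (Meaningful for `q` not an
endpoint of `x`.) [folklore] -/
def compressVal (q : ℕ) : ℕ :=
  q - (if (G.overPos x : ℕ) < q then 1 else 0) - (if (G.underPos x : ℕ) < q then 1 else 0)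

/-- The compressed value of a point other than the endpoints of `x` is below `2 (n - 1)`. [folklore] -/
theorem compressVal_lt {q : Fin (2 * G.n)} (hqo : q ≠ G.overPos x) (hqu : q ≠ G.underPos x) :
    G.compressVal x q < 2 * (G.n - 1) := by
  unfold compressVal
  have h1 := q.isLt; have h2 := (G.overPos x).isLt; have h3 := (G.underPos x).isLt
  have h4 : (q : ℕ) ≠ G.overPos x := fun h ↦ hqo (Fin.ext h)
  have h5 : (q : ℕ) ≠ G.underPos x := fun h ↦ hqu (Fin.ext h)
  have h6 : (G.overPos x : ℕ) ≠ G.underPos x := fun h ↦ G.overPos_ne_underPos x x (Fin.ext h)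
  split_ifs <;> omega

/-- **The lift of a chord index of the erased diagram** to a chord index of `G` (skip `x`). [folklore] -/
def liftIdx (i : Fin (G.n - 1)) : Fin G.n :=
  ⟨if (i : ℕ) < x then i else i + 1, by have := i.isLt; split_ifs <;> omega⟩

/-- The value of a lifted index. [folklore] -/
theorem val_liftIdx (i : Fin (G.n - 1)) : (G.liftIdx x i : ℕ) = if (i : ℕ) < x then (i : ℕ) else i + 1 := rfl

/-- A lifted index is not `x`. [folklore] -/
theorem liftIdx_ne (i : Fin (G.n - 1)) : G.liftIdx x i ≠ x := by
  intro h
  have := congrArg Fin.val h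
  rw [val_liftIdx] at this
  split_ifs at this <;> omega

/-- `liftIdx` is injective. [folklore] -/
theorem liftIdx_injective : Function.Injective (G.liftIdx x) := by
  intro i j h
  have := congrArg Fin.val h
  rw [val_liftIdx, val_liftIdx] at this
  apply Fin.ext
  split_ifs at this <;> omega

/-- The compressed position of an endpoint of another chord, as a marked point of the erased
diagram. [folklore] -/
def compressPt (q : Fin (2 * G.n)) (hqo : q ≠ G.overPos x) (hqu : q ≠ G.underPos x) : Fin (2 * (G.n - 1)) :=
  ⟨G.compressVal x q, G.compressVal_lt x hqo hqu⟩

/-- Compression is injective on the points other than the endpoints of `x`. [folklore] -/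
theorem compressVal_injective {q q' : Fin (2 * G.n)} (hqo : q ≠ G.overPos x) (hqu : q ≠ G.underPos x)
    (hqo' : q' ≠ G.overPos x) (hqu' : q' ≠ G.underPos x) (h : G.compressVal x q = G.compressVal x q') : q = q' := by
  unfold compressVal at h
  have h4 : (q : ℕ) ≠ G.overPos x := fun h ↦ hqo (Fin.ext h)
  have h5 : (q : ℕ) ≠ G.underPos x := fun h ↦ hqu (Fin.ext h)
  have h4' : (q' : ℕ) ≠ G.overPos x := fun h ↦ hqo' (Fin.ext h)
  have h5' : (q' : ℕ) ≠ G.underPos x := fun h ↦ hqu' (Fin.ext h)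
  have h6 : (G.overPos x : ℕ) ≠ G.underPos x := fun h ↦ G.overPos_ne_underPos x x (Fin.ext h)
  apply Fin.ext
  split_ifs at h <;> omega

/-- **The Gauss diagram with the chord `x` erased.** Polyak (2010), §2 (deleting an arrow).
[cite: Polyak2010, §2] -/
def eraseChord : GaussDiagram where
  n := G.n - 1
  overPos i := G.compressPt x (G.overPos (G.liftIdx x i))
    (fun h ↦ G.liftIdx_ne x i (G.overPos_injective h)) (G.overPos_ne_underPos _ _)
  underPos i := G.compressPt x (G.underPos (G.liftIdx x i))
    (fun h ↦ (G.overPos_ne_underPos _ _) h.symm) (fun h ↦ G.liftIdx_ne x i (G.underPos_injective h))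
  sign i := G.sign (G.liftIdx x i)
  bijective := by
    classical
    refine (Fintype.bijective_iff_injective_and_card _).2 ⟨?_, by simp; omega⟩
    rintro (i | i) (j | j) h <;> simp only [Sum.elim_inl, Sum.elim_inr, compressPt, Fin.mk.injEq] at h
    · exact congrArg Sum.inl (G.liftIdx_injective x (G.overPos_injective
        (G.compressVal_injective x (fun h ↦ G.liftIdx_ne x i (G.overPos_injective h)) (G.overPos_ne_underPos _ _)
          (fun h ↦ G.liftIdx_ne x j (G.overPos_injective h)) (G.overPos_ne_underPos _ _) h)))
    · exact absurd (G.compressVal_injective x (fun h ↦ G.liftIdx_ne x i (G.overPos_injective h)) (G.overPos_ne_underPos _ _)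
          (fun h ↦ (G.overPos_ne_underPos _ _) h.symm) (fun h ↦ G.liftIdx_ne x j (G.underPos_injective h)) h)
        (G.overPos_ne_underPos _ _)
    · exact absurd (G.compressVal_injective x (fun h ↦ (G.overPos_ne_underPos _ _) h.symm)
          (fun h ↦ G.liftIdx_ne x i (G.underPos_injective h))
          (fun h ↦ G.liftIdx_ne x j (G.overPos_injective h)) (G.overPos_ne_underPos _ _) h)
        (fun h ↦ G.overPos_ne_underPos _ _ h.symm)
    · exact congrArg Sum.inr (G.liftIdx_injective x (G.underPos_injective
        (G.compressVal_injective x (fun h ↦ (G.overPos_ne_underPos _ _) h.symm)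
          (fun h ↦ G.liftIdx_ne x i (G.underPos_injective h))
          (fun h ↦ (G.overPos_ne_underPos _ _) h.symm) (fun h ↦ G.liftIdx_ne x j (G.underPos_injective h)) h)))

/-- The erased diagram has one chord less. [folklore] -/
@[simp] theorem eraseChord_n : (G.eraseChord x).n = G.n - 1 := rfl

/-- The over-passages of the erased diagram, as numbers. [folklore] -/
theorem val_overPos_eraseChord (i : Fin (G.n - 1)) :
    ((G.eraseChord x).overPos i : ℕ) = G.compressVal x (G.overPos (G.liftIdx x i)) := rfl

/-- The under-passages of the erased diagram, as numbers. [folklore] -/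
theorem val_underPos_eraseChord (i : Fin (G.n - 1)) :
    ((G.eraseChord x).underPos i : ℕ) = G.compressVal x (G.underPos (G.liftIdx x i)) := rfl

/-- The signs of the erased diagram. [folklore] -/
@[simp] theorem sign_eraseChord (i : Fin (G.n - 1)) : (G.eraseChord x).sign i = G.sign (G.liftIdx x i) := rfl


/-! ## Reconstruction: re-inserting the erased chord -/

section Reconstruct

include x in
/-- `G` has at least one chord (there is `x`). [folklore] -/
theorem one_le_n : 1 ≤ G.n := by have := x.isLt; omega

/-- **The renumbering of the chords of `G` putting `x` last** and keeping the order of the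
others: `j ↦ liftIdx x j` for `j < n - 1`, `n - 1 ↦ x`. [folklore] -/
def eraseCycleFun (j : Fin G.n) : Fin G.n :=
  if h : (j : ℕ) < G.n - 1 then G.liftIdx x ⟨j, h⟩ else x

/-- The renumbering is injective. [folklore] -/
theorem eraseCycleFun_injective : Function.Injective (G.eraseCycleFun x) := by
  intro i j h
  unfold eraseCycleFun at h
  by_cases hi : (i : ℕ) < G.n - 1 <;> by_cases hj : (j : ℕ) < G.n - 1
  · rw [dif_pos hi, dif_pos hj] at h
    exact Fin.ext (by simpa using congrArg Fin.val (G.liftIdx_injective x h))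
  · rw [dif_pos hi, dif_neg hj] at h; exact absurd h (G.liftIdx_ne x _)
  · rw [dif_neg hi, dif_pos hj] at h; exact absurd h.symm (G.liftIdx_ne x _)
  · apply Fin.ext; have := i.isLt; have := j.isLt; omega

/-- **The renumbering of the chords of `G` putting `x` last**, as a permutation. [folklore] -/
noncomputable def eraseCycle : Equiv.Perm (Fin G.n) :=
  Equiv.ofBijective (G.eraseCycleFun x) (Finite.injective_iff_bijective.1 (G.eraseCycleFun_injective x))

/-- The value of the renumbering below `n - 1`. [folklore] -/
theorem eraseCycle_apply_of_lt (j : Fin G.n) (hj : (j : ℕ) < G.n - 1) :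
    G.eraseCycle x j = G.liftIdx x ⟨j, hj⟩ := by
  show G.eraseCycleFun x j = _
  unfold eraseCycleFun; rw [dif_pos hj]

/-- The renumbering sends `n - 1` to `x`. [folklore] -/
theorem eraseCycle_apply_of_not_lt (j : Fin G.n) (hj : ¬ (j : ℕ) < G.n - 1) : G.eraseCycle x j = x := by
  show G.eraseCycleFun x j = _
  unfold eraseCycleFun; rw [dif_neg hj]

/-- **The old over-passage of `x`**, as a position for re-insertion. [folklore] -/
def eraseO : Fin (2 * (G.eraseChord x).n + 2) :=
  ⟨G.overPos x, by
    have := (G.overPos x).isLt; have := G.one_le_n x; have hf : (G.eraseChord x).n = G.n - 1 := rfl; omega⟩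

/-- **The old under-passage of `x`**, as the second parameter of re-insertion. [folklore] -/
def eraseU : Fin (2 * (G.eraseChord x).n + 1) :=
  ⟨if (G.overPos x : ℕ) < G.underPos x then (G.underPos x : ℕ) - 1 else G.underPos x, by
    have := (G.overPos x).isLt; have := (G.underPos x).isLt; have := G.one_le_n x
    have hf : (G.eraseChord x).n = G.n - 1 := rfl
    have h6 : (G.overPos x : ℕ) ≠ G.underPos x := fun h ↦ G.overPos_ne_underPos x x (Fin.ext h)
    split_ifs <;> omega⟩

/-- The value of `eraseO`. [folklore] -/
@[simp] theorem val_eraseO : (G.eraseO x : ℕ) = G.overPos x := rfl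

/-- The value of `eraseU`. [folklore] -/
theorem val_eraseU : (G.eraseU x : ℕ) =
    if (G.overPos x : ℕ) < G.underPos x then (G.underPos x : ℕ) - 1 else G.underPos x := rfl

/-- Re-inserting at `eraseO`, `eraseU` restores a compressed point. [folklore] -/
theorem val_insEmb_compress {q : Fin (2 * G.n)} (hqo : q ≠ G.overPos x) (hqu : q ≠ G.underPos x) :
    ((G.eraseChord x).insEmb (G.eraseO x) (G.eraseU x) (G.compressPt x q hqo hqu) : ℕ) = q := by
  have hv : (G.compressPt x q hqo hqu : ℕ) = G.compressVal x q := rfl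
  have hf : (G.eraseChord x).n = G.n - 1 := rfl
  rw [val_insEmb, hv, val_eraseU, val_eraseO]
  unfold compressVal
  have h4 : (q : ℕ) ≠ G.overPos x := fun h ↦ hqo (Fin.ext h)
  have h5 : (q : ℕ) ≠ G.underPos x := fun h ↦ hqu (Fin.ext h)
  have h6 : (G.overPos x : ℕ) ≠ G.underPos x := fun h ↦ G.overPos_ne_underPos x x (Fin.ext h)
  split_ifs <;> omega

/-- The second new point of the re-insertion is the old under-passage of `x`. [folklore] -/
theorem val_succAbove_eraseO_eraseU : ((G.eraseO x).succAbove (G.eraseU x) : ℕ) = G.underPos x := by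
  rw [val_succAbove, val_eraseU, val_eraseO]
  have h6 : (G.overPos x : ℕ) ≠ G.underPos x := fun h ↦ G.overPos_ne_underPos x x (Fin.ext h)
  split_ifs <;> omega

/-- **Reconstruction of `G` from the erased diagram**: re-inserting the erased chord at its old
positions gives `G` with its chords renumbered so that `x` comes last. Polyak (2010), §2.
[cite: Polyak2010, §2] -/
theorem insertChord_eraseChord :
    (G.eraseChord x).insertChord (G.eraseO x) (G.eraseU x) (G.sign x) = G.relabel (G.eraseCycle x) := by
  have hn : (G.eraseChord x).n + 1 = G.n := by show G.n - 1 + 1 = G.n; have := G.one_le_n x; omega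
  refine ext_of_val hn (fun i j hij ↦ ?_) (fun i j hij ↦ ?_) (fun i j hij ↦ ?_)
  · show _ = (G.overPos (G.eraseCycle x j) : ℕ)
    rcases Fin.eq_castSucc_or_eq_last i with ⟨k, rfl⟩ | rfl
    · have hj : (j : ℕ) < G.n - 1 := by rw [← hij]; exact k.isLt
      rw [G.eraseCycle_apply_of_lt x j hj, insertChord_overPos_castSucc_eq]
      have ek : G.liftIdx x ⟨j, hj⟩ = G.liftIdx x k := by congr 1; exact Fin.ext hij.symm
      rw [ek]
      exact G.val_insEmb_compress x (fun h ↦ G.liftIdx_ne x k (G.overPos_injective h)) (G.overPos_ne_underPos _ _)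
    · have hj : ¬ (j : ℕ) < G.n - 1 := by rw [← hij]; simp
      rw [G.eraseCycle_apply_of_not_lt x j hj, insertChord_overPos_last]; rfl
  · show _ = (G.underPos (G.eraseCycle x j) : ℕ)
    rcases Fin.eq_castSucc_or_eq_last i with ⟨k, rfl⟩ | rfl
    · have hj : (j : ℕ) < G.n - 1 := by rw [← hij]; exact k.isLt
      rw [G.eraseCycle_apply_of_lt x j hj, insertChord_underPos_castSucc_eq]
      have ek : G.liftIdx x ⟨j, hj⟩ = G.liftIdx x k := by congr 1; exact Fin.ext hij.symm
      rw [ek]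
      exact G.val_insEmb_compress x (fun h ↦ (G.overPos_ne_underPos _ _) h.symm)
        (fun h ↦ G.liftIdx_ne x k (G.underPos_injective h))
    · have hj : ¬ (j : ℕ) < G.n - 1 := by rw [← hij]; simp
      rw [G.eraseCycle_apply_of_not_lt x j hj, insertChord_underPos_last]
      exact G.val_succAbove_eraseO_eraseU x
  · show _ = G.sign (G.eraseCycle x j)
    rcases Fin.eq_castSucc_or_eq_last i with ⟨k, rfl⟩ | rfl
    · have hj : (j : ℕ) < G.n - 1 := by rw [← hij]; exact k.isLt
      rw [G.eraseCycle_apply_of_lt x j hj, insertChord_sign_castSucc]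
      show G.sign (G.liftIdx x k) = _
      congr 1; congr 1; exact Fin.ext hij
    · have hj : ¬ (j : ℕ) < G.n - 1 := by rw [← hij]; simp
      rw [G.eraseCycle_apply_of_not_lt x j hj, insertChord_sign_last]

end Reconstruct


/-! ## Erasing an isolated kink -/

section Kink

/-- For a kink entered along the under-strand (`overPos x = underPos x + 1`) the re-insertion
parameters are `(p.succ, p)`. [folklore] -/
theorem eraseO_eq_succ (h : (G.overPos x : ℕ) = G.underPos x + 1) : G.eraseO x = (G.eraseU x).succ := by
  apply Fin.ext
  rw [Fin.val_succ, val_eraseU, val_eraseO]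
  split_ifs <;> omega

/-- For a kink entered along the over-strand (`underPos x = overPos x + 1`) the re-insertion
parameters are `(p.castSucc, p)`. [folklore] -/
theorem eraseO_eq_castSucc (h : (G.underPos x : ℕ) = G.overPos x + 1) : G.eraseO x = (G.eraseU x).castSucc := by
  apply Fin.ext
  rw [Fin.val_castSucc, val_eraseU, val_eraseO]
  split_ifs <;> omega

/-- **An isolated kink entered along the under-strand can be erased without changing Khovanov
homology**: `Kh^{i,j}(G) ≅ Kh^{i,j}(G.eraseChord x)` when `overPos x = underPos x + 1` (the first
Reidemeister move `Ω1b` read backwards, and independence of the numbering of the chords).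
Khovanov (2000), §5.1, §3.3. [cite: Khovanov2000, §5.1] -/
theorem nonempty_iso_khovanovHomology_eraseChord_of_kink_under (h : (G.overPos x : ℕ) = G.underPos x + 1) (i j : ℤ) :
    Nonempty (G.khovanovHomology i j ≅ (G.eraseChord x).khovanovHomology i j) := by
  obtain ⟨e₁⟩ := nonempty_iso_khovanovHomology_relabel G (G.eraseCycle x) i j
  obtain ⟨e₂⟩ := (G.eraseChord x).nonempty_iso_khovanovHomology_omega1b (G.eraseU x) (G.sign x) i j
  rw [← G.eraseO_eq_succ x h, G.insertChord_eraseChord x] at e₂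
  exact ⟨e₁ ≪≫ e₂.symm⟩

/-- **An isolated kink entered along the over-strand can be erased without changing Khovanov
homology**: `Kh^{i,j}(G) ≅ Kh^{i,j}(G.eraseChord x)` when `underPos x = overPos x + 1` (`Ω1a`
backwards). Khovanov (2000), §5.1, §3.3. [cite: Khovanov2000, §5.1] -/
theorem nonempty_iso_khovanovHomology_eraseChord_of_kink_over (h : (G.underPos x : ℕ) = G.overPos x + 1) (i j : ℤ) :
    Nonempty (G.khovanovHomology i j ≅ (G.eraseChord x).khovanovHomology i j) := by
  obtain ⟨e₁⟩ := nonempty_iso_khovanovHomology_relabel G (G.eraseCycle x) i j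
  obtain ⟨e₂⟩ := (G.eraseChord x).nonempty_iso_khovanovHomology_omega1a (G.eraseU x) (G.sign x) i j
  rw [← G.eraseO_eq_castSucc x h, G.insertChord_eraseChord x] at e₂
  exact ⟨e₁ ≪≫ e₂.symm⟩

end Kink

end GaussDiagram

end Literature.Topology.FourManifolds
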